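import Literature.AlgebraicTopology.SingularHomology.SuspensionDecomposition
import Literature.AlgebraicTopology.SingularHomology.ProjectiveFibreStep
import Literature.AlgebraicTopology.SingularHomology.ProductWithContractible
import HarnessLib

/-!
# Base classes on product pieces `T × P₀` with `P₀` contractible; the unit cocycle

Topic `Literature/AlgebraicTopology/SingularHomology`. A. Hatcher, *Algebraic Topology* (2002),
§3.1 p. 201 (homotopy invariance: `pr₁* : H*(U) ≅ H*(U × C)` for contractible `C`) and §3.2
p. 211 (the unit of the cohomology ring); D. Husemoller, *Fibre Bundles*, 3rd ed. (1994),
Ch. 17 §1 (the Leray–Hirsch theorem over a product with a cell is immediate).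

For the tree's pull-back of base classes `pullT p W : H*(T) → H*_X(W)` (`SuspensionDecomposition`)
we PROVE:

* `prodPieceHomeomorph` — `↥(pr₂⁻¹ P₀) ≃ₜ T × ↥P₀` inside `T × F`;
* `pullT_bijective_of_factor` — `p*` onto `H*_X(W)` is bijective as soon as `p ∘ (↥W → X)` factors
  as a cohomology isomorphism after a homeomorphism; hence
  **`pullT_fst_bijective_of_contractible`**: `pr₁* : H*(T) ≅ H*_{T × F}(T × P₀)` for `↥P₀`
  contractible (Hatcher §3.1 p. 201);
* the unit: `clsOfCocycle 1 = 1`, `cupRightH 1 = 𝟙` (`cupRightH_cochainOne`), and `pullT p W 0 1` is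
  independent of `p` (`pullT_one_eq`).

Everything is proved; no named facts.

## References

* [HatcherAT2002] A. Hatcher, *Algebraic Topology*, CUP 2002, §3.1 p. 201, §3.2 p. 211.
* [HusemollerFibreBundles1994] D. Husemoller, *Fibre Bundles*, 3rd ed. (1994), Ch. 17 §1 Thm. 1.1.
-/

noncomputable section

-- as in `SuspensionDecomposition`: chains of the concrete complex are `Finsupp`s up to unfolding
-- of semireducible definitions
set_option backward.isDefEq.respectTransparency false

open CategoryTheory Limits

universe u v

namespace Literature.AlgebraicTopology.SingularHomology

namespace SimplexSpan

variable {R : Type v} [CommRing R] {X : Type u} [TopologicalSpace X] (𝒮 : SimplexSpan R X)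

/-- **`⌣ (r • β) = r • (⌣ β)` on cohomology.** [cite: HatcherAT2002, §3.2 p. 206] -/
theorem cupRightH_smul_right (hS : 𝒮.FrontBackClosed) {p dd n : ℕ} (r : R) (β : SingularSimplex X dd → R)
    (hβ : (singularCochainComplex R R X).d dd (dd + 1) β = 0)
    (hrβ : (singularCochainComplex R R X).d dd (dd + 1) (r • β) = 0) (h : p + dd = n) (x : 𝒮.cochains.homology p) :
    𝒮.cupRightH hS (r • β) hrβ h x = r • 𝒮.cupRightH hS β hβ h x := by
  obtain ⟨ψ, hψ, rfl⟩ := homologyCls_surjective x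
  have hz := 𝒮.d_next_cupRight_eq_zero hS β hβ h ψ hψ
  have hz' : 𝒮.cochains.d n ((ComplexShape.down ℕ).symm.next n) (r • 𝒮.cupRight β h ψ) = 0 := by
    rw [map_smul, hz, smul_zero]
  rw [𝒮.cupRightH_homologyCls hS _ hrβ h ψ hψ, 𝒮.cupRightH_homologyCls hS β hβ h ψ hψ, ← homologyCls_smul r _ hz hz']
  exact homologyCls_congr (𝒮.cupRight_smul_right r β h ψ) _ _

end SimplexSpan

namespace subsetCochains

variable {R : Type v} [CommRing R]

/-- Local notation: the coefficient object `ULift R` of `ModuleCat.{max u v} R`. -/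
local notation "𝑹" => SimplexSpan.coefR R

/-! ### Product pieces -/

section Pieces

variable {T F : Type u} [TopologicalSpace T] [TopologicalSpace F]

variable (T) in
/-- **`↥(pr₂⁻¹ P₀) ≃ₜ T × ↥P₀`** for `P₀ ⊆ F`. [folklore] -/
def prodPieceHomeomorph (P₀ : Set F) : ↥((Prod.snd : T × F → F) ⁻¹' P₀) ≃ₜ T × ↥P₀ where
  toFun x := (x.1.1, ⟨x.1.2, x.2⟩)
  invFun y := ⟨(y.1, (y.2 : F)), y.2.2⟩
  left_inv _ := rfl
  right_inv _ := rfl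
  continuous_toFun := (continuous_fst.comp continuous_subtype_val).prodMk
    ((continuous_snd.comp continuous_subtype_val).subtype_mk _)
  continuous_invFun := (continuous_fst.prodMk (continuous_subtype_val.comp continuous_snd)).subtype_mk _

variable {X : Type u} [TopologicalSpace X] (p : C(X, T))

/-- **`p*` onto `H*_X(W)` is bijective when `p ∘ (↥W → X) = g ∘ Ψ`** for a homeomorphism `Ψ` and a
map `g` inducing bijections on cohomology. [cite: HatcherAT2002, §3.1 p. 201] -/
theorem pullT_bijective_of_factor {W : Set X} {Y : Type u} [TopologicalSpace Y] (Ψ : ↥W ≃ₜ Y) (g : C(Y, T))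
    (hg : ∀ j, Function.Bijective (singularCohomology.map R R g j))
    (hfac : p.comp (valMap W) = g.comp (Ψ : C(↥W, Y))) (j : ℕ) :
    Function.Bijective (pullT (R := R) p W j) := by
  rw [pullT_bijective_iff, hfac, singularCohomology.map_comp]
  exact ((ConcreteCategory.isIso_iff_bijective _).1
    (inferInstance : IsIso (singularCohomology.mapIso R R (Ψ : ↥W ≃ₜ Y) j).hom)).comp (hg j)

/-- **`pr₁* : H*(T) → H*_{T × F}(T × P₀)` is bijective for `↥P₀` contractible** (Hatcher 2002,
§3.1 p. 201: `U × C ≃ U`; Husemoller Ch. 17 §1: the cell pieces of the Leray–Hirsch argument).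
[cite: HatcherAT2002, §3.1 p. 201] -/
theorem pullT_fst_bijective_of_contractible (P₀ : Set F) [ContractibleSpace ↥P₀] (j : ℕ) :
    Function.Bijective (pullT (R := R) (ContinuousMap.fst : C(T × F, T)) ((Prod.snd : T × F → F) ⁻¹' P₀) j) := by
  haveI : Nonempty ↥P₀ := (ContractibleSpace.hequiv_unit (X := ↥P₀)).some.invFun.1 () |> fun x ↦ ⟨x⟩
  exact pullT_bijective_of_factor (R := R) ContinuousMap.fst (prodPieceHomeomorph T P₀)
    (ContinuousMap.fst : C(T × ↥P₀, T)) (fun j ↦ map_fst_bijective R R j) rfl j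

end Pieces

/-! ### The unit cocycle -/

section Unit

variable {X T : Type u} [TopologicalSpace X] [TopologicalSpace T] (p : C(X, T))

/-- The class of the unit cocycle is the unit of the cohomology ring. [cite: HatcherAT2002, §3.2 p. 211] -/
theorem clsOfCocycle_cochainOne (h : (singularCochainComplex R R X).d 0 1 (cochainOne R X) = 0) :
    clsOfCocycle (cochainOne R X) h = singularCohomology.one R X := by
  rw [clsOfCocycle, homologyCls_eq_homologyπ_cyclesMk _ _ 1 (by simp) h]
  rfl

/-- The unit cocycle pulls back to the unit cocycle. [folklore] -/
theorem map_cochainOne {Y : Type u} [TopologicalSpace Y] (f : C(X, Y)) :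
    (singularCochainComplex.map R R f).f 0 (cochainOne R Y) = cochainOne R X := rfl

/-- **`⌣ 1 = 𝟙` on `H*_X(W)`.** [cite: HatcherAT2002, §3.2 p. 211] -/
theorem cupRightH_cochainOne (W : Set X) (h : (singularCochainComplex R R X).d 0 1 (cochainOne R X) = 0)
    {m : ℕ} (hm : m + 0 = m) (y : (subsetCochains R 𝑹 W).homology m) :
    (SimplexSpan.ofSet (R := R) W).cupRightH (SimplexSpan.frontBackClosed_ofSet _) (cochainOne R X) h hm y = y := by
  apply iso_injective
  rw [homologyIsoSingularCohomology_hom_cupRightH, clsOfCocycle_cochainOne, singularCohomology.map_one]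
  exact cupProduct_one _

/-- **The unit class `p* 1 ∈ H⁰_X(W)` does not depend on `p`.** [folklore] -/
theorem pullT_one_eq {T' : Type u} [TopologicalSpace T'] (p' : C(X, T')) (W : Set X) :
    pullT p W 0 (singularCohomology.one R T) = pullT p' W 0 (singularCohomology.one R T') := by
  apply iso_injective
  rw [iso_pullT, iso_pullT, singularCohomology.map_one, singularCohomology.map_one]

/-- The unit class restricts to the unit class. [folklore] -/
theorem resH_pullT_one {W W' : Set X} (hW : W' ⊆ W) :
    resH (N := 𝑹) hW 0 (pullT p W 0 (singularCohomology.one R T)) = pullT p W' 0 (singularCohomology.one R T) :=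
  resH_pullT p hW 0 _

/-- **`s ⌣ p^♯1 = s`**: the action of the unit base cocycle is the identity. [cite: HatcherAT2002, §3.2 p. 211] -/
theorem sAct_cochainOne (S : Set X) {N : ℕ} (hN : N + 0 = N)
    (h1 : (singularCochainComplex R R T).d 0 1 (cochainOne R T) = 0) (s : (subsetCochains R 𝑹 S).homology N) :
    sAct p S hN (cochainOne R T) h1 s = s := by
  rw [sAct_apply]
  exact (LinearMap.congr_fun (cupRightH_congr_fun (SimplexSpan.ofSet (R := R) S) (SimplexSpan.frontBackClosed_ofSet _)
    (map_cochainOne p) (map_d_eq_zero p _ h1) (d_cochainOne R) hN) s).trans (cupRightH_cochainOne S (d_cochainOne R) hN s)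

/-- **`s ⌣ p^♯(m • 1) = m • s`.** [cite: HatcherAT2002, §3.2 p. 211] -/
theorem sAct_smul_cochainOne (S : Set X) {N : ℕ} (hN : N + 0 = N) (m : R)
    (hφ : (singularCochainComplex R R T).d 0 1 (m • cochainOne R T) = 0)
    (s : (subsetCochains R 𝑹 S).homology N) : sAct p S hN (m • cochainOne R T) hφ s = m • s := by
  rw [sAct_apply]
  have h1 : (singularCochainComplex R R X).d 0 1 ((singularCochainComplex.map R R p).f 0 (cochainOne R T)) = 0 :=
    map_d_eq_zero p _ (d_cochainOne R)
  have hlin : (singularCochainComplex.map R R p).f 0 (m • cochainOne R T) =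
      m • (singularCochainComplex.map R R p).f 0 (cochainOne R T) := map_smul _ _ _
  have hm1 : (singularCochainComplex R R X).d 0 1 (m • (singularCochainComplex.map R R p).f 0 (cochainOne R T)) = 0 := by
    rw [map_smul, h1, smul_zero]
  rw [LinearMap.congr_fun (cupRightH_congr_fun (SimplexSpan.ofSet (R := R) S) (SimplexSpan.frontBackClosed_ofSet _)
    hlin (map_d_eq_zero p _ hφ) hm1 hN) s,
    (SimplexSpan.ofSet (R := R) S).cupRightH_smul_right (SimplexSpan.frontBackClosed_ofSet _) m _ h1 hm1 hN s]
  exact congrArg (m • ·) (sAct_cochainOne p S hN (d_cochainOne R) s)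

end Unit

end subsetCochains

end Literature.AlgebraicTopology.SingularHomology
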